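import Literature.NumberTheory.EllipticCurves.BinaryQuarticCongruenceEnvelopesProofs
import Literature.NumberTheory.EllipticCurves.BinaryQuarticDiscriminantDensityProofs
import Mathlib.NumberTheory.SumPrimeReciprocals
import HarnessLib

/-!
# The integrals of the congruence envelopes: range `[0,1]`, monotonicity in the level, and the
# tail bound `∫ ψ_{p,n} ≥ 1 − μ_p(W_p) ≥ 1 − 10/p²` for acceptable weights

`Proofs` companion (theorems only: no definitions, no named facts) bridging
`BinaryQuarticCongruenceEnvelopesProofs.lean` (the envelopes `ψ_n = inf φ(C_n(·))`,
`ψ'_n = sup φ(C_n(·))` of a weight `φ : V_{ℤ_p} → [0,1]`) and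
`BinaryQuarticDiscriminantDensityProofs.lean` (`μ_p(W_p) ≤ 10/p²`, `W_p = {p² ∣ Δ}`) to the
hypotheses of the abstract sieve `BhargavaShankarSieveSkeletonProofs.lean`. Source: M. Bhargava,
A. Shankar, *Binary quartic forms having bounded invariants, and the boundedness of the average rank
of elliptic curves*, Ann. of Math. (2) 181 (2015) 191–242, §2.7 of the published version
(= `arXiv:1006.1002v3`), proof of Thm 2.21.

In the notation of `BhargavaShankar.eventually_prod_le_tprod_add` /
`BhargavaShankar.eventually_tprod_sub_le_prod` (index `i = p`, `aᵢ = ∫ φ_p`,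
`a'ᵢ(n) = ∫ ψ_{p,n}`, `bᵢ(n) = ∫ ψ'_{p,n}`) this file supplies:

* `aᵢ, a'ᵢ(n), bᵢ(n) ∈ [0,1]` (`integral_mem_Icc_of_mem_Icc`, `integral_sInf_image_congr_mem_Icc`,
  `integral_sSup_image_congr_mem_Icc`);
* `a'ᵢ` increasing, `bᵢ` decreasing in `n` (`monotone_integral_sInf_image_congr`,
  `antitone_integral_sSup_image_congr`); their convergence to `aᵢ` is
  `tendsto_integral_sInf_image_congr` / `tendsto_integral_sSup_image_congr` of the companion file;
* for a weight acceptable at `p` (`φ = 1` off `W_p`) and `n ≥ 2`: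
  `a'ᵢ(n) ≥ 1 − μ_p(W_p) ≥ 1 − 10/p²` (`one_sub_volume_le_integral_sInf_image_congr`,
  `one_sub_ten_div_sq_le_integral_sInf_image_congr`), the trivial `a'ᵢ(n) ≥ 1 − 1` at the other
  primes, and display (27) of the source, `1 − ∫ φ_p ≤ μ_p(W_p) ≤ 10/p²`
  (`one_sub_integral_le_of_acceptable`);
* `∑_p 10/p² < ∞` (`summable_ten_div_sq_primes`).

## References

* M. Bhargava, A. Shankar, Ann. of Math. (2) 181 (2015) 191–242, §2.7, proof of Thm 2.21,
  displays (26)–(27) (published numbering). [cite: BhargavaShankarAnnals2015, §2.7, proof of Thm 2.21 (published numbering)]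
-/

noncomputable section

open scoped Classical Topology
open Filter Set MeasureTheory

namespace Literature.NumberTheory.EllipticCurves

namespace BinaryQuartic

variable {p : ℕ} [Fact p.Prime]

/-! ## §1. Integrals of `[0,1]`-valued functions on the probability space `V_{ℤ_p}` -/

/-- A measurable `[0,1]`-valued function on `V_{ℤ_p}` is integrable. [folklore] -/
theorem integrable_of_measurable_of_mem_Icc {g : BinaryQuartic ℤ_[p] → ℝ} (hg : Measurable g)
    (h0 : ∀ f, 0 ≤ g f) (h1 : ∀ f, g f ≤ 1) : Integrable g (volume : Measure (BinaryQuartic ℤ_[p])) := by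
  refine ⟨hg.aestronglyMeasurable, HasFiniteIntegral.of_bounded (C := 1) (Eventually.of_forall fun f => ?_)⟩
  rw [Real.norm_eq_abs, abs_le]
  exact ⟨by linarith [h0 f], h1 f⟩

/-- Its integral lies in `[0,1]` (`μ_p(V_{ℤ_p}) = 1`). [folklore] -/
theorem integral_mem_Icc_of_mem_Icc {g : BinaryQuartic ℤ_[p] → ℝ}
    (h0 : ∀ f, 0 ≤ g f) (h1 : ∀ f, g f ≤ 1) :
    0 ≤ ∫ f, g f ∂(volume : Measure (BinaryQuartic ℤ_[p])) ∧
      ∫ f, g f ∂(volume : Measure (BinaryQuartic ℤ_[p])) ≤ 1 := by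
  refine ⟨integral_nonneg h0, ?_⟩
  calc ∫ f, g f ∂(volume : Measure (BinaryQuartic ℤ_[p]))
        ≤ ∫ _f, (1 : ℝ) ∂(volume : Measure (BinaryQuartic ℤ_[p])) :=
          integral_mono_of_nonneg (Eventually.of_forall h0) (integrable_const 1) (Eventually.of_forall h1)
    _ = 1 := by simp

/-! ## §2. The integrals of the envelopes: range, monotonicity -/

/-- `∫ ψ_n ∈ [0,1]`. [folklore] -/
theorem integral_sInf_image_congr_mem_Icc {φ : BinaryQuartic ℤ_[p] → ℝ} (h0 : ∀ f, 0 ≤ φ f)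
    (h1 : ∀ f, φ f ≤ 1) (n : ℕ) :
    0 ≤ ∫ f : BinaryQuartic ℤ_[p],
        sInf (φ '' {g : BinaryQuartic ℤ_[p] | ∀ i, (p : ℤ_[p]) ^ n ∣ g.coeffs i - f.coeffs i}) ∧
      (∫ f : BinaryQuartic ℤ_[p],
        sInf (φ '' {g : BinaryQuartic ℤ_[p] | ∀ i, (p : ℤ_[p]) ^ n ∣ g.coeffs i - f.coeffs i})) ≤ 1 :=
  integral_mem_Icc_of_mem_Icc (fun f => sInf_image_congr_nonneg h0 n f)
    fun f => sInf_image_congr_le_one h0 h1 n f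

/-- `∫ ψ'_n ∈ [0,1]`. [folklore] -/
theorem integral_sSup_image_congr_mem_Icc {φ : BinaryQuartic ℤ_[p] → ℝ} (h0 : ∀ f, 0 ≤ φ f)
    (h1 : ∀ f, φ f ≤ 1) (n : ℕ) :
    0 ≤ ∫ f : BinaryQuartic ℤ_[p],
        sSup (φ '' {g : BinaryQuartic ℤ_[p] | ∀ i, (p : ℤ_[p]) ^ n ∣ g.coeffs i - f.coeffs i}) ∧
      (∫ f : BinaryQuartic ℤ_[p],
        sSup (φ '' {g : BinaryQuartic ℤ_[p] | ∀ i, (p : ℤ_[p]) ^ n ∣ g.coeffs i - f.coeffs i})) ≤ 1 :=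
  integral_mem_Icc_of_mem_Icc (fun f => sSup_image_congr_nonneg h0 h1 n f)
    fun f => sSup_image_congr_le_one h1 n f

/-- **`n ↦ ∫ ψ_n` is increasing** ("an increasing sequence `ψ_{p,1} ≤ ψ_{p,2} ≤ ⋯`",
Bhargava–Shankar 2015, proof of Thm 2.21). [cite: BhargavaShankarAnnals2015, §2.7, proof of Thm 2.21 (published numbering)] -/
theorem monotone_integral_sInf_image_congr {φ : BinaryQuartic ℤ_[p] → ℝ} (h0 : ∀ f, 0 ≤ φ f)
    (h1 : ∀ f, φ f ≤ 1) :
    Monotone fun n : ℕ => ∫ f : BinaryQuartic ℤ_[p],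
      sInf (φ '' {g : BinaryQuartic ℤ_[p] | ∀ i, (p : ℤ_[p]) ^ n ∣ g.coeffs i - f.coeffs i}) := by
  intro m n hmn
  exact integral_mono
    (integrable_of_measurable_of_mem_Icc (measurable_sInf_image_congr φ m)
      (fun f => sInf_image_congr_nonneg h0 m f) fun f => sInf_image_congr_le_one h0 h1 m f)
    (integrable_of_measurable_of_mem_Icc (measurable_sInf_image_congr φ n)
      (fun f => sInf_image_congr_nonneg h0 n f) fun f => sInf_image_congr_le_one h0 h1 n f)
    fun f => monotone_sInf_image_congr h0 f hmn

/-- **`n ↦ ∫ ψ'_n` is decreasing** ("a decreasing sequence `1 = ψ'_{p,0} ≥ ψ'_{p,1} ≥ ⋯`").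
[cite: BhargavaShankarAnnals2015, §2.7, proof of Thm 2.21 (published numbering)] -/
theorem antitone_integral_sSup_image_congr {φ : BinaryQuartic ℤ_[p] → ℝ} (h0 : ∀ f, 0 ≤ φ f)
    (h1 : ∀ f, φ f ≤ 1) :
    Antitone fun n : ℕ => ∫ f : BinaryQuartic ℤ_[p],
      sSup (φ '' {g : BinaryQuartic ℤ_[p] | ∀ i, (p : ℤ_[p]) ^ n ∣ g.coeffs i - f.coeffs i}) := by
  intro m n hmn
  exact integral_mono
    (integrable_of_measurable_of_mem_Icc (measurable_sSup_image_congr φ n)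
      (fun f => sSup_image_congr_nonneg h0 h1 n f) fun f => sSup_image_congr_le_one h1 n f)
    (integrable_of_measurable_of_mem_Icc (measurable_sSup_image_congr φ m)
      (fun f => sSup_image_congr_nonneg h0 h1 m f) fun f => sSup_image_congr_le_one h1 m f)
    fun f => antitone_sSup_image_congr h1 f hmn

/-! ## §3. Acceptable weights: `∫ ψ_n ≥ 1 − μ_p(W_p) ≥ 1 − 10/p²` for `n ≥ 2` -/

/-- For a weight `φ` with `φ = 1` off `W_p = {p² ∣ Δ}` and a level `n ≥ 2`, the lower envelope
dominates the indicator function of `V_{ℤ_p} ∖ W_p`. [folklore] -/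
theorem indicator_compl_le_sInf_image_congr {φ : BinaryQuartic ℤ_[p] → ℝ} (h0 : ∀ f, 0 ≤ φ f)
    (hacc : ∀ g : BinaryQuartic ℤ_[p], ¬ (p : ℤ_[p]) ^ 2 ∣ g.disc → φ g = 1) {n : ℕ} (hn : 2 ≤ n)
    (f : BinaryQuartic ℤ_[p]) :
    ({g : BinaryQuartic ℤ_[p] | (p : ℤ_[p]) ^ 2 ∣ g.disc}ᶜ).indicator (fun _ => (1 : ℝ)) f ≤
      sInf (φ '' {g : BinaryQuartic ℤ_[p] | ∀ i, (p : ℤ_[p]) ^ n ∣ g.coeffs i - f.coeffs i}) := by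
  by_cases hf : (p : ℤ_[p]) ^ 2 ∣ f.disc
  · rw [indicator_of_notMem (by simpa using hf)]
    exact sInf_image_congr_nonneg h0 n f
  · rw [indicator_of_mem (by simpa using hf), (sInf_eq_one_and_sSup_eq_one_of_not_sq_dvd_disc hacc hn hf).1]

/-- **`∫ ψ_n ≥ 1 − μ_p(W_p)`** for an acceptable weight at `p` and `n ≥ 2`. [cite: BhargavaShankarAnnals2015, §2.7, proof of Thm 2.21 (published numbering)] -/
theorem one_sub_volume_le_integral_sInf_image_congr {φ : BinaryQuartic ℤ_[p] → ℝ} (h0 : ∀ f, 0 ≤ φ f)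
    (h1 : ∀ f, φ f ≤ 1)
    (hacc : ∀ g : BinaryQuartic ℤ_[p], ¬ (p : ℤ_[p]) ^ 2 ∣ g.disc → φ g = 1) {n : ℕ} (hn : 2 ≤ n) :
    1 - (volume {g : BinaryQuartic ℤ_[p] | (p : ℤ_[p]) ^ 2 ∣ g.disc}).toReal ≤
      ∫ f : BinaryQuartic ℤ_[p],
        sInf (φ '' {g : BinaryQuartic ℤ_[p] | ∀ i, (p : ℤ_[p]) ^ n ∣ g.coeffs i - f.coeffs i}) := by
  have hW : MeasurableSet {g : BinaryQuartic ℤ_[p] | (p : ℤ_[p]) ^ 2 ∣ g.disc} :=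
    measurableSet_setOf_sq_dvd_disc
  calc 1 - (volume {g : BinaryQuartic ℤ_[p] | (p : ℤ_[p]) ^ 2 ∣ g.disc}).toReal
        = (volume {g : BinaryQuartic ℤ_[p] | (p : ℤ_[p]) ^ 2 ∣ g.disc}ᶜ).toReal := by
          rw [prob_compl_eq_one_sub hW, ENNReal.toReal_sub_of_le prob_le_one ENNReal.one_ne_top,
            ENNReal.toReal_one]
    _ = ∫ f, ({g : BinaryQuartic ℤ_[p] | (p : ℤ_[p]) ^ 2 ∣ g.disc}ᶜ).indicator (fun _ => (1 : ℝ)) f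
          ∂(volume : Measure (BinaryQuartic ℤ_[p])) := by
          rw [integral_indicator hW.compl, setIntegral_const, smul_eq_mul, mul_one]
          rfl
    _ ≤ _ := by
          refine integral_mono_of_nonneg (Eventually.of_forall fun f => ?_)
            (integrable_of_measurable_of_mem_Icc (measurable_sInf_image_congr φ n)
              (fun f => sInf_image_congr_nonneg h0 n f) fun f => sInf_image_congr_le_one h0 h1 n f)
            (Eventually.of_forall fun f => indicator_compl_le_sInf_image_congr h0 hacc hn f)
          exact indicator_nonneg (fun _ _ => zero_le_one) f

/-- **`∫ ψ_n ≥ 1 − 10/p²`** for an acceptable weight at `p` and `n ≥ 2` — the input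
`a'ᵢ(n) ≥ 1 − cᵢ`, `∑ cᵢ < ∞` of the exchange of the level limit with the Euler product
(`Literature.NumberTheory.EllipticCurves.BhargavaShankar.eventually_tprod_sub_le_prod`), by the
density bound `μ_p(W_p) ≤ 10/p²` (`padicInt_volume_real_setOf_sq_dvd_disc_le`).
[cite: BhargavaShankarAnnals2015, §2.7, proof of Thm 2.21 (published numbering)] -/
theorem one_sub_ten_div_sq_le_integral_sInf_image_congr {φ : BinaryQuartic ℤ_[p] → ℝ}
    (h0 : ∀ f, 0 ≤ φ f) (h1 : ∀ f, φ f ≤ 1)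
    (hacc : ∀ g : BinaryQuartic ℤ_[p], ¬ (p : ℤ_[p]) ^ 2 ∣ g.disc → φ g = 1) {n : ℕ} (hn : 2 ≤ n) :
    1 - 10 / (p : ℝ) ^ 2 ≤
      ∫ f : BinaryQuartic ℤ_[p],
        sInf (φ '' {g : BinaryQuartic ℤ_[p] | ∀ i, (p : ℤ_[p]) ^ n ∣ g.coeffs i - f.coeffs i}) := by
  have h := padicInt_volume_real_setOf_sq_dvd_disc_le p
  linarith [one_sub_volume_le_integral_sInf_image_congr h0 h1 hacc hn]

/-- The trivial form of the same bound, valid at every prime (for the finitely many primes at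
which a weight is not acceptable one takes `cᵢ = 1`): `1 − 1 ≤ ∫ ψ_n`. [folklore] -/
theorem one_sub_one_le_integral_sInf_image_congr {φ : BinaryQuartic ℤ_[p] → ℝ} (h0 : ∀ f, 0 ≤ φ f)
    (n : ℕ) :
    (1 : ℝ) - 1 ≤ ∫ f : BinaryQuartic ℤ_[p],
        sInf (φ '' {g : BinaryQuartic ℤ_[p] | ∀ i, (p : ℤ_[p]) ^ n ∣ g.coeffs i - f.coeffs i}) := by
  rw [sub_self]
  exact integral_nonneg fun f => sInf_image_congr_nonneg h0 n f

/-- **`1 − ∫ φ ≤ μ_p(W_p) ≤ 10/p²`** for an acceptable weight at `p` — display (27) of the proof of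
Thm 2.21: "since `φ` is acceptable we have `1 − ∫_{V_{ℤ_p}} φ_p(f) df ≤ ∫_{p² ∣ Δ(f)} df ≪ p⁻²`".
[cite: BhargavaShankarAnnals2015, §2.7, proof of Thm 2.21, display (27) (published numbering)] -/
theorem one_sub_integral_le_of_acceptable {φ : BinaryQuartic ℤ_[p] → ℝ} (h0 : ∀ f, 0 ≤ φ f)
    (h1 : ∀ f, φ f ≤ 1)
    (hlc : ∀ᵐ f ∂(volume : Measure (BinaryQuartic ℤ_[p])), ∀ᶠ g in 𝓝 f, φ g = φ f)
    (hacc : ∀ g : BinaryQuartic ℤ_[p], ¬ (p : ℤ_[p]) ^ 2 ∣ g.disc → φ g = 1) :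
    1 - ∫ f, φ f ∂(volume : Measure (BinaryQuartic ℤ_[p])) ≤ 10 / (p : ℝ) ^ 2 := by
  have h2 := one_sub_ten_div_sq_le_integral_sInf_image_congr h0 h1 hacc (le_refl 2)
  have h3 := (integral_sInf_le_integral_le_integral_sSup h0 h1 hlc 2).1
  linarith

/-! ## §4. Summability over the primes -/

/-- `∑_p 10/p² < ∞` over the primes. [folklore] -/
theorem summable_ten_div_sq_primes : Summable fun q : Nat.Primes => (10 : ℝ) / (q : ℝ) ^ 2 := by
  have h := (Nat.Primes.summable_rpow (r := -2)).mpr (by norm_num)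
  refine (h.mul_left 10).congr fun q => ?_
  have hq : (0 : ℝ) < q := by exact_mod_cast q.2.pos
  rw [Real.rpow_neg hq.le, div_eq_mul_inv]
  norm_num

end BinaryQuartic

end Literature.NumberTheory.EllipticCurves

end
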